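import Summits.ResolutionOfSingularities.ResolutionOfSingularities.Theorems.FrobeniusClosingPatchingRelPerfectDepthLegalPointMove
import Literature.AlgebraicGeometry.Resolution.StrictTransformCurveDelta
import HarnessLib

/-!
# Crux `PatchingRelPerfect` (stmt-ResolutionOfSingularities-16161), chain W5.2 — T6-E1b residual `LegalScopedDivisorReduction₃`,
# PHASE 2 closer (2b), brick B4/A1 (part 2): the TRACE of the boundary on the strict transform of the host through a POINT MOVE

[OURS · L1 W5.2 · res-L1-w52-stub-1 g4 for B4 «STEP A»] Replaces the role of NO printed item; NOT a statement of the manuscript under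
review; fact-free.  Companion of `…DepthLegalPointMove`: with `X = V(D)`, `X′ = V(τᶜ(D,1))`, `π_X : X′ → X` over the point blow-up `τ`
at `p`, `T := (monomialIdeal L)|_X`, `T′ := (monomialIdeal L′)|_{X′}`:
* `support_trace_pointMove_subset` — UPPER: `Supp T′ ⊆ π_X⁻¹ Supp T` (the new boundary monomial is `τᶜ(M,1)`, supported over `Supp M`);
* `mem_support_trace_pointMove_iff` — LOWER, off the exceptional curve: `x′ ∈ Supp T′ ↔ π_X x′ ∈ Supp T` (there the controlled
  transform is the total transform);
* `comap_subschemeι_vanishingIdeal_singleton` — `𝓘_E({p})·𝒪_X = 𝓘_X({x})` for `ι x = p`: the centre of `π_X` (B1's `isBlowup_host`)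
  is the point ideal of `X`, the input of blow-up uniqueness for the identification with the Cossart–Jannsen–Saito surface.
AI-written; AI review is weaker than expert review.

## References
* J. Włodarczyk, J. AMS 18 (2005), Lemma 3.10.3 (restriction commutes with the controlled transform). [Wlodarczyk2005]
* E. Bierstone, D. Grigoriev, P. Milman, J. Włodarczyk, arXiv:1206.3090, §4 Remark (3). [BierstoneGrigorievMilmanWlodarczyk2011]
-/

-- `Summit.<Summit>.<Sub>.Theorems` with `Sub = Summit` (single-conjunct summit, D-0017)
set_option linter.dupNamespace false

noncomputable section

open CategoryTheory CategoryTheory.Limits AlgebraicGeometry TopologicalSpace IsLocalRing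
open Literature.AlgebraicGeometry.Resolution Scheme.IdealSheafData

namespace Summit.ResolutionOfSingularities.ResolutionOfSingularities.Theorems

universe u

namespace DepthLegal

open WeightTwoB DepthTargets

variable {E : Scheme.{u}}

namespace HostState

/-! ## §5 The trace on the strict transform of the host: supports through the point move -/

section Trace

variable [IsLocallyNoetherian E] {H D : E.IdealSheafData} {L : List (E.IdealSheafData × ℕ)} (S : HostState H D L)
  {p : E} (hp : IsClosed ({p} : Set E)) {E' : Scheme.{u}} {τ : E' ⟶ E}

omit [IsLocallyNoetherian E] in
/-- Pre-images along a commutative square `πX ≫ ι = ι′ ≫ τ` (set form). [folklore] -/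
theorem preimage_comm_sq {X X' : Scheme.{u}} {ι : X ⟶ E} {ι' : X' ⟶ E'} {πX : X' ⟶ X} (hπX : πX ≫ ι = ι' ≫ τ)
    (A : Set E) : ι' ⁻¹' (τ ⁻¹' A) = πX ⁻¹' (ι ⁻¹' A) := by
  ext x
  simp only [Set.mem_preimage]
  rw [← Scheme.Hom.comp_apply, ← hπX, Scheme.Hom.comp_apply]

include S in
/-- **UPPER: the new trace is supported over the old trace.**  With `T = M|_X`, `T′ = M′|_{X′}` (`M′ = τᶜ(M,1)`), and
`π_X : X′ → X` over `τ`: `Supp T′ ⊆ π_X⁻¹ Supp T`. [folklore] -/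
theorem support_trace_pointMove_subset (hpM : p ∈ (monomialIdeal L).support) (hτ : IsBlowup τ (vanishingIdeal ⟨{p}, hp⟩))
    (πX : (controlledTransform τ (vanishingIdeal ⟨{p}, hp⟩) D 1).subscheme ⟶ D.subscheme)
    (hπX : πX ≫ D.subschemeι = (controlledTransform τ (vanishingIdeal ⟨{p}, hp⟩) D 1).subschemeι ≫ τ) :
    (((monomialIdeal (stepExp L τ (vanishingIdeal ⟨{p}, hp⟩) (weightAt L p - 1))).comap
        (controlledTransform τ (vanishingIdeal ⟨{p}, hp⟩) D 1).subschemeι).support : Set _) ⊆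
      πX ⁻¹' ((monomialIdeal L).comap D.subschemeι).support := by
  haveI : IsLocallyNoetherian E' := hτ.isLocallyNoetherian
  have hM' : monomialIdeal (stepExp L τ (vanishingIdeal ⟨{p}, hp⟩) (weightAt L p - 1)) =
      controlledTransform τ (vanishingIdeal ⟨{p}, hp⟩) (monomialIdeal L) 1 :=
    (S.bd_transform (isGenericPoint_singleton hp) (Set.singleton_subset_iff.mpr hpM)
      (hasSNCWith_vanishingIdeal_singleton S.sncB hp) hτ).symm
  intro x' hx'
  rw [Scheme.IdealSheafData.support_comap, Closeds.coe_preimage, hM'] at hx'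
  have h := support_controlledTransform_subset_preimage (π := τ) (C := vanishingIdeal ⟨{p}, hp⟩) (monomialIdeal L) 1 hx'
  rw [Set.mem_preimage, Scheme.IdealSheafData.support_comap, Closeds.coe_preimage, Set.mem_preimage]
  have h2 : x' ∈ (controlledTransform τ (vanishingIdeal ⟨{p}, hp⟩) D 1).subschemeι ⁻¹' (τ ⁻¹' ((monomialIdeal L).support : Set E)) := h
  rw [preimage_comm_sq hπX] at h2
  exact h2

include S in
/-- **LOWER (off the exceptional curve): the new trace agrees with the pulled-back old trace.**  At a point `x′ ∈ X′` NOT over `p`: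
`x′ ∈ Supp T′ ↔ π_X x′ ∈ Supp T` (off the centre the controlled transform is the total transform). [folklore] -/
theorem mem_support_trace_pointMove_iff (hpM : p ∈ (monomialIdeal L).support) (hτ : IsBlowup τ (vanishingIdeal ⟨{p}, hp⟩))
    (πX : (controlledTransform τ (vanishingIdeal ⟨{p}, hp⟩) D 1).subscheme ⟶ D.subscheme)
    (hπX : πX ≫ D.subschemeι = (controlledTransform τ (vanishingIdeal ⟨{p}, hp⟩) D 1).subschemeι ≫ τ)
    {x' : (controlledTransform τ (vanishingIdeal ⟨{p}, hp⟩) D 1).subscheme}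
    (hx' : τ ((controlledTransform τ (vanishingIdeal ⟨{p}, hp⟩) D 1).subschemeι x') ≠ p) :
    x' ∈ ((monomialIdeal (stepExp L τ (vanishingIdeal ⟨{p}, hp⟩) (weightAt L p - 1))).comap
        (controlledTransform τ (vanishingIdeal ⟨{p}, hp⟩) D 1).subschemeι).support ↔
      πX x' ∈ ((monomialIdeal L).comap D.subschemeι).support := by
  haveI : IsLocallyNoetherian E' := hτ.isLocallyNoetherian
  set ι' := (controlledTransform τ (vanishingIdeal ⟨{p}, hp⟩) D 1).subschemeι with hι'
  have hM' : monomialIdeal (stepExp L τ (vanishingIdeal ⟨{p}, hp⟩) (weightAt L p - 1)) =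
      controlledTransform τ (vanishingIdeal ⟨{p}, hp⟩) (monomialIdeal L) 1 :=
    (S.bd_transform (isGenericPoint_singleton hp) (Set.singleton_subset_iff.mpr hpM)
      (hasSNCWith_vanishingIdeal_singleton S.sncB hp) hτ).symm
  have hoff : τ (ι' x') ∉ ((vanishingIdeal (⟨{p}, hp⟩ : Closeds E)).support : Set E) := by
    rw [Scheme.IdealSheafData.coe_support_vanishingIdeal]; exact hx'
  -- stalks: `T′_{x′} = (M′)_{ι′x′}·𝒪 = (M𝒪_{E′})_{ι′x′}·𝒪 = ((M|_X)·𝒪_{X′})_{x′}`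
  have hst : stalkIdeal ((monomialIdeal (stepExp L τ (vanishingIdeal ⟨{p}, hp⟩) (weightAt L p - 1))).comap ι') x' =
      stalkIdeal (((monomialIdeal L).comap D.subschemeι).comap πX) x' := by
    rw [hM', stalkIdeal_comap_eq_map_stalkMap, hτ.stalkIdeal_controlledTransform_of_not_mem (monomialIdeal L) 1 hoff,
      ← stalkIdeal_comap_eq_map_stalkMap, ← Scheme.IdealSheafData.comap_comp, ← Scheme.IdealSheafData.comap_comp, hπX]
  rw [mem_support_iff_stalkIdeal_le, mem_support_iff_stalkIdeal_le, hst, stalkIdeal_comap_eq_map_stalkMap]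
  constructor
  · intro h
    by_contra hnot
    have htop : stalkIdeal ((monomialIdeal L).comap D.subschemeι) (πX x') = ⊤ :=
      not_not.mp fun hne => hnot (IsLocalRing.le_maximalIdeal hne)
    rw [htop, Ideal.map_top, top_le_iff] at h
    exact (IsLocalRing.maximalIdeal.isMaximal _).ne_top h
  · intro h
    refine (Ideal.map_mono h).trans (Ideal.map_le_iff_le_comap.mpr fun a ha => ?_)
    rw [Ideal.mem_comap, IsLocalRing.mem_maximalIdeal, mem_nonunits_iff]
    exact fun hu => (IsLocalRing.mem_maximalIdeal _).mp ha ((isUnit_map_iff (πX.stalkMap x').hom a).mp hu)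

end Trace

/-! ## §6 The point ideal along the host immersion -/

section PointIdeal

variable {D : E.IdealSheafData} {p : E} (hp : IsClosed ({p} : Set E))

/-- **The ideal of the point `p ∈ X = V(D)` restricts to the ideal of the point of `X`**: for the closed immersion
`ι : V(D) ↪ E` and `x ∈ V(D)` with `ι x = p`, `𝓘_E({p})·𝒪_X = 𝓘_X({x})` (stalks: `𝔪_{E,p} ↠ 𝔪_{X,x}` at `x`, the unit ideal
elsewhere). [folklore] -/
theorem comap_subschemeι_vanishingIdeal_singleton {x : D.subscheme} (hx : D.subschemeι x = p)
    (hxc : IsClosed ({x} : Set D.subscheme)) :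
    (vanishingIdeal ⟨{p}, hp⟩).comap D.subschemeι = vanishingIdeal ⟨{x}, hxc⟩ := by
  refine le_antisymm (le_of_forall_stalkIdeal_le fun y => ?_) (le_of_forall_stalkIdeal_le fun y => ?_)
  · by_cases hy : y = x
    · subst hy
      rw [stalkIdeal_comap_vanishingIdeal_singleton D.subschemeι hp hx, stalkIdeal_vanishingIdeal_singleton hxc]
    · have hy' : y ∉ ((vanishingIdeal (⟨{x}, hxc⟩ : Closeds D.subscheme)).support : Set D.subscheme) := by
        rw [Scheme.IdealSheafData.coe_support_vanishingIdeal]; exact hy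
      rw [stalkIdeal_eq_top_of_not_mem_support hy']
      exact le_top
  · by_cases hy : y = x
    · subst hy
      rw [stalkIdeal_comap_vanishingIdeal_singleton D.subschemeι hp hx, stalkIdeal_vanishingIdeal_singleton hxc]
    · have hy' : y ∉ (((vanishingIdeal (⟨{p}, hp⟩ : Closeds E)).comap D.subschemeι).support : Set D.subscheme) := by
        rw [Scheme.IdealSheafData.support_comap, Closeds.coe_preimage, Scheme.IdealSheafData.coe_support_vanishingIdeal]
        intro h
        exact hy (D.subschemeι.isClosedEmbedding.injective (h.trans hx.symm))
      rw [stalkIdeal_eq_top_of_not_mem_support hy']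
      exact le_top

end PointIdeal

end HostState

end DepthLegal

end Summit.ResolutionOfSingularities.ResolutionOfSingularities.Theorems
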